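import Literature.AnabelianGeometry.SemiGraphs.WitnessIwahoriBundle
import Literature.AnabelianGeometry.SemiGraphs.UniversalCoveringCompactInVerticial
import Mathlib.RingTheory.ZMod.UnitsCyclic
import HarnessLib

/-!
# The estranged loop `𝒢₁` is COHERENT — and [SemiAnbd] Thm 3.7 (iii)/(iv) hold AT its universal
# graph-covering `𝒢₁,∞` (the bi-infinite Iwahori chain), literally

S. Mochizuki, *Semi-graphs of anabelioids*, Publ. RIMS **42** (2006), Def. 2.3 (iii) p. 25 ("We shall say
that `𝒢` is *coherent* if `𝒢` is quasi-coherent and, moreover, each of the profinite groups `π̂₁(𝒢_c)` is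
topologically finitely generated"), Thm. 3.7 (iii)/(iv) pp. 40–41; [IUTchI] Rmk. 2.5.3 (i) (T3) p. 53
("if `𝒢` is finite and coherent, then it is strictly coherent").
[cite: MochizukiSemiAnbd2006, Def 2.3(iii) p.25]

PROOF-ONLY file (cell abc-iut, layer L3; seat abc-iut-w6-d120; no definition, no new named fact).  The
cell's standard Thm-3.7 witness WITH AN EDGE is abc-iut-w5-d236's estranged loop
`IwahoriWitness.loopGraph p` (one vertex with group `P = ℤ_p ⋊ (1 + pℤ_p)` = `Iw p`, one loop with group
`U = 1 + pℤ_p` = `IwU p`, branch maps the torus and a twisted complement; `loopGraph_thm37Hypotheses`,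
`loopGraph_isQuasiCoherent`).  This file adds the one adjective that was missing, COHERENCE, whose content
beyond quasi-coherence is the topological finite generation of `U` and `P`:

* `IwU.topologicalClosure_closure_pair` — `U = 1 + pℤ_p` (additive coordinate `s ↔ 1 + p s`) is
  topologically generated by `1 + p` and `1 + 2p` (the second generator is only used at `p = 2`, where
  `1 + 2p = 5`).  Proof by successive approximation through the level boxes `ker(U → U_n)`
  (`IwU.exists_level_subset_of_mem_nhds`): the `p`-th power of a level-`m` uniformizer `1 + p^{m+1}c`,
  `c ∈ ℤ_pˣ`, is a level-`(m+1)` uniformizer as soon as `p ≠ 2 ∨ m ≥ 1` (Mathlib's binomial lemma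
  `ZMod.exists_one_add_mul_pow_prime_eq`), and a level-`m` uniformizer kills the `m`-th digit of any
  element of the level-`m` box [cite: IrelandRosen1990, Ch. 4 §1 Thms. 2, 2′];
* `Iw.topologicalClosure_closure_triple` — `P = ℤ_p ⋊ U` is topologically generated by the translation
  `(1, 0)` (ℕ is dense in `ℤ_p`) and the torus elements `(0, 1)`, `(0, 2)` (`P = ℤ_p · T_0`);
* `IwahoriWitness.loopGraph_isCoherent`, `loopGraph_isStrictlyCoherent` — `𝒢₁` is coherent (Def. 2.3 (iii))
  and strictly coherent ([IUTchI] Rmk. 2.5.3 (i) (T3), via `isStrictlyCoherent_of_finite`);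
* the LITERAL instances of abc-iut-w6-d120's `UniversalCoveringCompactInVerticial` (p456054) at `𝒢₁`,
  now hypothesis-free: `compactInVerticialAt_univCover_loopGraph`, `maximalCompactIffVerticialAt_univCover_loopGraph`,
  `thm37Hypotheses_univCover_loopGraph` (+ the finite-`F` forms `…_univCoverOver_loopGraph`) — the typed
  F-1732 / F-1750 At-forms `CompactInVerticialAt` / `MaximalCompactIffVerticialAt` HOLD at the covering
  semi-graph of anabelioids `𝒢₁,∞` of the universal graph-covering of the estranged loop (the bi-infinite,
  locally finite chain of copies of `P` glued along `U`), a GENUINE infinite carrier beside the negative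
  θ-ray `𝒢_θ` (`not_compactInVerticial` p442260, `not_maximalCompactIffVerticial` p443103).

Nothing here concerns the disputed corpus; no side is taken on [IUTchIII] Cor. 3.12; typed ≠ proved.
-/

noncomputable section

open Topology

namespace Literature.AnabelianGeometry.SemiGraphs

open IwahoriWitness

variable {p : ℕ} [Fact p.Prime]

/-! ## 1. `U = 1 + pℤ_p` is topologically generated by `1 + p` and `1 + 2p` -/

namespace IwU

/-- Membership in the level-`m` box `ker(U → U_m)` as divisibility of the coordinate: `p^m ∣ s`.
[cite: MochizukiSemiAnbd2006, Def 2.3(i) p.24] -/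
theorem toMod_eq_one_iff_dvd (m : ℕ) (y : IwU p) : toMod m y = 1 ↔ (p : ℤ_[p]) ^ m ∣ y.s := by
  rw [toMod_eq_one_iff, PadicInt.norm_le_pow_iff_mem_span_pow, Ideal.mem_span_singleton]

/-- `w` of a power is the power of `w`: `1 + p (z^k).s = (1 + p z.s)^k`. [cite: MochizukiSemiAnbd2006, §2 p.23] -/
theorem w_pow (z : IwU p) (k : ℕ) : w p (z ^ k).s = (w p z.s) ^ k := by
  induction k with
  | zero => simp [w]
  | succ k ih => rw [pow_succ, w_mul, ih, pow_succ]

/-- Powers inside the level-`m` box are additive on the `m`-th digit: if `z.s = p^m c` then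
`(z^j).s = p^m (j c + p r)` for some `r`. [cite: IrelandRosen1990, Ch. 4 §1 Thm. 2 (proof)] -/
theorem exists_pow_s_eq (m : ℕ) (z : IwU p) (c : ℤ_[p]) (hz : z.s = (p : ℤ_[p]) ^ m * c) (j : ℕ) :
    ∃ r : ℤ_[p], (z ^ j).s = (p : ℤ_[p]) ^ m * (j * c + p * r) := by
  induction j with
  | zero => exact ⟨0, by simp⟩
  | succ j ih =>
    obtain ⟨r, hr⟩ := ih
    refine ⟨r + (p : ℤ_[p]) ^ m * (j * c + p * r) * c, ?_⟩
    rw [pow_succ, mul_s, hr, hz]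
    push_cast
    ring

/-- DIGIT KILLING: an element `y` of the level-`m` box times a suitable power of a level-`m` uniformizer
`z` (`z.s = p^m c`, `c ∈ ℤ_pˣ`) lies in the level-`(m+1)` box (solve `t + j c ≡ 0 (mod p)` in `𝔽_p`).
[cite: IrelandRosen1990, Ch. 4 §1 Thm. 2 (proof)] -/
theorem exists_mul_pow_toMod_succ_eq_one (m : ℕ) (y z : IwU p) (hy : toMod m y = 1) (c : ℤ_[p])
    (hc : IsUnit c) (hz : z.s = (p : ℤ_[p]) ^ m * c) :
    ∃ j : ℕ, toMod (m + 1) (y * z ^ j) = 1 := by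
  haveI : NeZero p := ⟨(Fact.out : p.Prime).ne_zero⟩
  rw [toMod_eq_one_iff_dvd] at hy
  obtain ⟨t, ht⟩ := hy
  obtain ⟨u, hu⟩ := hc.map PadicInt.toZMod
  set jbar : ZMod p := -(PadicInt.toZMod t) * ↑u⁻¹ with hjbar
  refine ⟨jbar.val, ?_⟩
  obtain ⟨r, hr⟩ := exists_pow_s_eq m z c hz jbar.val
  have hdig : (p : ℤ_[p]) ∣ t + (jbar.val : ℤ_[p]) * c := by
    rw [← Ideal.mem_span_singleton, ← PadicInt.maximalIdeal_eq_span_p, ← PadicInt.ker_toZMod,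
      RingHom.mem_ker, map_add, map_mul, map_natCast, ZMod.natCast_zmod_val, hjbar, ← hu, mul_assoc,
      Units.inv_mul, mul_one, add_neg_cancel]
  obtain ⟨q, hq⟩ := hdig
  rw [toMod_eq_one_iff_dvd, mul_s, hr, ht]
  exact ⟨q + r + (p : ℤ_[p]) ^ m * t * ((jbar.val : ℤ_[p]) * c + p * r), by
    linear_combination (p : ℤ_[p]) ^ m * hq⟩

/-- The `p`-TH POWER OF A UNIFORMIZER: if `z.s = p^m c` with `c ∈ ℤ_pˣ` and `p ≠ 2 ∨ m ≥ 1`, then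
`(z^p).s = p^{m+1} c'` with `c' ∈ ℤ_pˣ` — i.e. `(1 + p^{m+1} c)^p = 1 + p^{m+2} c'` (binomial theorem;
the excluded case is `(1 + 2c)^2 = 1 + 8·c(1+c)/2` at `p = 2`, `m = 0`).
[cite: IrelandRosen1990, Ch. 4 §1 Thms. 2, 2′ (proof)] -/
theorem exists_pow_prime_s_eq (m : ℕ) (z : IwU p) (c : ℤ_[p]) (hc : IsUnit c)
    (hz : z.s = (p : ℤ_[p]) ^ m * c) (hm : p ≠ 2 ∨ 1 ≤ m) :
    ∃ c' : ℤ_[p], IsUnit c' ∧ (z ^ p).s = (p : ℤ_[p]) ^ (m + 1) * c' := by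
  have hp : p.Prime := Fact.out
  have hexp : m + 1 + 1 + 1 ≤ (m + 1) * p := by
    rcases hm with h2 | h1
    · have h3 : 3 ≤ p := by have := hp.two_le; omega
      calc m + 1 + 1 + 1 ≤ (m + 1) * 3 := by omega
        _ ≤ (m + 1) * p := Nat.mul_le_mul_left _ h3
    · calc m + 1 + 1 + 1 ≤ (m + 1) * 2 := by omega
        _ ≤ (m + 1) * p := Nat.mul_le_mul_left _ hp.two_le
  obtain ⟨y, hy⟩ := ZMod.exists_one_add_mul_pow_prime_eq (R := ℤ_[p]) (u := (p : ℤ_[p]) ^ (m + 1))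
    (v := (p : ℤ_[p])) hp (dvd_pow_self _ (Nat.succ_ne_zero m)) (by
      rw [← pow_succ', ← pow_succ, ← pow_mul]
      exact pow_dvd_pow _ hexp) c
  refine ⟨c + p * y, ?_, ?_⟩
  · obtain ⟨cu, rfl⟩ := hc
    have h1 : (cu : ℤ_[p]) * w p (↑cu⁻¹ * y) = ↑cu + ↑p * y := by
      rw [w, mul_add, mul_one, mul_left_comm, Units.mul_inv_cancel_left]
    rw [← h1]
    exact (Units.isUnit cu).mul (isUnit_w p _)
  · have hw : w p (z ^ p).s = (1 + (p : ℤ_[p]) ^ (m + 1) * c) ^ p := by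
      rw [w_pow]; congr 1; simp only [w, hz]; ring
    rw [hy] at hw
    simp only [w] at hw
    have hp0 : (p : ℤ_[p]) ≠ 0 := by exact_mod_cast hp.ne_zero
    apply mul_left_cancel₀ hp0
    linear_combination hw

/-- UNIFORMIZERS AT EVERY LEVEL in the subgroup generated by `s = 1` (`1 + p`) and `s = 2` (`1 + 2p`):
level `0` is `s = 1`; `p`-th powers climb one level, except `0 → 1` at `p = 2`, supplied by `s = 2`
(`5 = 1 + 4`). [cite: IrelandRosen1990, Ch. 4 §1 Thms. 2, 2′] -/
theorem exists_mem_closure_s_eq (m : ℕ) :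
    ∃ z ∈ Subgroup.closure ({⟨1⟩, ⟨2⟩} : Set (IwU p)),
      ∃ c : ℤ_[p], IsUnit c ∧ z.s = (p : ℤ_[p]) ^ m * c := by
  induction m with
  | zero => exact ⟨⟨1⟩, Subgroup.subset_closure (Set.mem_insert _ _), 1, isUnit_one, by simp⟩
  | succ m ih =>
    obtain ⟨z, hz, c, hc, hzs⟩ := ih
    by_cases h : p ≠ 2 ∨ 1 ≤ m
    · obtain ⟨c', hc', h'⟩ := exists_pow_prime_s_eq m z c hc hzs h
      exact ⟨z ^ p, Subgroup.pow_mem _ hz p, c', hc', h'⟩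
    · push Not at h
      obtain ⟨hp2, hm⟩ := h
      have hm0 : m = 0 := by omega
      subst hm0
      refine ⟨⟨2⟩, Subgroup.subset_closure (Set.mem_insert_of_mem _ rfl), 1, isUnit_one, ?_⟩
      subst hp2
      simp

/-- LEVEL-WISE APPROXIMATION: every `x ∈ U` is congruent modulo the level-`m` box to an element of the
subgroup generated by `s = 1`, `s = 2`. [cite: IrelandRosen1990, Ch. 4 §1 Thms. 2, 2′] -/
theorem exists_mem_closure_toMod_eq_one (m : ℕ) (x : IwU p) :
    ∃ h ∈ Subgroup.closure ({⟨1⟩, ⟨2⟩} : Set (IwU p)), toMod m (x⁻¹ * h) = 1 := by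
  induction m with
  | zero =>
    exact ⟨1, Subgroup.one_mem _, by rw [toMod_eq_one_iff_dvd, pow_zero]; exact one_dvd _⟩
  | succ m ih =>
    obtain ⟨h, hh, hy⟩ := ih
    obtain ⟨z, hz, c, hc, hzs⟩ := exists_mem_closure_s_eq (p := p) m
    obtain ⟨j, hj⟩ := exists_mul_pow_toMod_succ_eq_one m (x⁻¹ * h) z hy c hc hzs
    exact ⟨h * z ^ j, Subgroup.mul_mem _ hh (Subgroup.pow_mem _ hz j), by rw [← mul_assoc]; exact hj⟩

/-- **`U = 1 + pℤ_p` is topologically generated by `1 + p` and `1 + 2p`** (coordinates `s = 1, 2`): the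
subgroup they generate is dense (it meets every level box around every point).
[cite: IrelandRosen1990, Ch. 4 §1 Thms. 2, 2′] -/
theorem topologicalClosure_closure_pair :
    (Subgroup.closure ({⟨1⟩, ⟨2⟩} : Set (IwU p))).topologicalClosure = ⊤ := by
  refine SetLike.coe_injective ?_
  rw [Subgroup.topologicalClosure_coe, Subgroup.coe_top]
  refine Set.eq_univ_of_forall fun x => ?_
  rw [mem_closure_iff_nhds]
  intro W hW
  have hV : (fun y => x * y) ⁻¹' W ∈ 𝓝 (1 : IwU p) := by
    refine (continuous_const_mul x).continuousAt.preimage_mem_nhds ?_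
    simpa using hW
  obtain ⟨n, hn⟩ := exists_level_subset_of_mem_nhds hV
  obtain ⟨h, hh, hy⟩ := exists_mem_closure_toMod_eq_one n x
  exact ⟨h, by simpa using hn _ hy, hh⟩

/-- `U` is topologically generated by a `Finset` of cardinality `≤ 2` (the shape consumed by
`ProfiniteSemiGraph.IsCoherent` / `IsStrictlyCoherent`). [cite: MochizukiSemiAnbd2006, Def 2.3(iii) p.25] -/
theorem exists_finset_topologicalClosure_eq_top :
    ∃ s : Finset (IwU p), s.card ≤ 2 ∧ (Subgroup.closure (s : Set (IwU p))).topologicalClosure = ⊤ := by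
  classical
  refine ⟨{⟨1⟩, ⟨2⟩}, Finset.card_le_two, ?_⟩
  rw [Finset.coe_insert, Finset.coe_singleton]
  exact topologicalClosure_closure_pair

end IwU

/-! ## 2. `P = ℤ_p ⋊ U` is topologically generated by `(1, 0)`, `(0, 1)`, `(0, 2)` -/

namespace Iw

/-- Powers of the unit translation: `(1, 0)^k = (k, 0)`. [cite: MochizukiSemiAnbd2006, §2 p.23] -/
theorem pow_transl (k : ℕ) : (⟨1, 0⟩ : Iw p) ^ k = ⟨(k : ℤ_[p]), 0⟩ := by
  induction k with
  | zero => ext <;> simp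
  | succ k ih => rw [pow_succ, ih]; ext <;> simp [w]

/-- The translation subgroup `{(a, 0)}` lies in the closure of any subgroup containing `(1, 0)` (ℕ is
dense in `ℤ_p`). [cite: MochizukiSemiAnbd2006, §2 p.23] -/
theorem transl_mem_topologicalClosure (H : Subgroup (Iw p)) (hα : (⟨1, 0⟩ : Iw p) ∈ H) (a : ℤ_[p]) :
    (⟨a, 0⟩ : Iw p) ∈ H.topologicalClosure := by
  have hf : Continuous fun b : ℤ_[p] => (⟨b, 0⟩ : Iw p) :=
    (continuous_mk_iff (p := p)).2 ⟨continuous_id, continuous_const⟩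
  have h1 : (⟨a, 0⟩ : Iw p) ∈
      (fun b : ℤ_[p] => (⟨b, 0⟩ : Iw p)) '' closure (Set.range (Nat.cast : ℕ → ℤ_[p])) :=
    ⟨a, by rw [PadicInt.denseRange_natCast.closure_range]; exact Set.mem_univ _, rfl⟩
  have h2 := image_closure_subset_closure_image hf h1
  rw [← SetLike.mem_coe, Subgroup.topologicalClosure_coe]
  refine closure_mono ?_ h2
  rintro _ ⟨_, ⟨k, rfl⟩, rfl⟩
  have hk := H.pow_mem hα k
  rw [pow_transl] at hk
  exact hk

/-- The torus `T_0 = {(0, s)}` lies in the closure of any subgroup containing `(0, 1)` and `(0, 2)`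
(image of `U`'s dense subgroup under the continuous `b_0 : U → P`). [cite: MochizukiSemiAnbd2006, §2 p.23] -/
theorem torus_mem_topologicalClosure (H : Subgroup (Iw p)) (h1 : (⟨0, 1⟩ : Iw p) ∈ H)
    (h2 : (⟨0, 2⟩ : Iw p) ∈ H) (s : ℤ_[p]) : (⟨0, s⟩ : Iw p) ∈ H.topologicalClosure := by
  set f : IwU p →* Iw p := (bHom (0 : ℤ_[p])).toMonoidHom with hf
  have hfc : Continuous f := (bHom (0 : ℤ_[p])).continuous_toFun
  have hfs : ∀ t : ℤ_[p], f ⟨t⟩ = ⟨0, t⟩ := fun t => by ext <;> simp [hf]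
  have hK : ((Subgroup.closure ({⟨1⟩, ⟨2⟩} : Set (IwU p))) : Set (IwU p)).image f ⊆ H := by
    rintro _ ⟨y, hy, rfl⟩
    have hmap : f y ∈ (Subgroup.closure ({⟨1⟩, ⟨2⟩} : Set (IwU p))).map f := ⟨y, hy, rfl⟩
    rw [MonoidHom.map_closure] at hmap
    refine (Subgroup.closure_le _).2 ?_ hmap
    rintro _ ⟨x, hx, rfl⟩
    rcases hx with rfl | rfl
    · rw [SetLike.mem_coe, hfs]; exact h1
    · rw [SetLike.mem_coe, hfs]; exact h2
  have hs : (⟨s⟩ : IwU p) ∈ closure ((Subgroup.closure ({⟨1⟩, ⟨2⟩} : Set (IwU p))) : Set (IwU p)) := by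
    rw [← Subgroup.topologicalClosure_coe, IwU.topologicalClosure_closure_pair, Subgroup.coe_top]
    exact Set.mem_univ _
  have himg := image_closure_subset_closure_image hfc ⟨_, hs, rfl⟩
  rw [← SetLike.mem_coe, Subgroup.topologicalClosure_coe, ← hfs s]
  exact closure_mono hK himg

/-- **`P = ℤ_p ⋊ (1 + pℤ_p)` is topologically generated by `(1, 0)`, `(0, 1)`, `(0, 2)`**
(`P = ℤ_p · T_0`). [cite: MochizukiSemiAnbd2006, Def 2.3(iii) p.25] -/
theorem topologicalClosure_closure_triple :
    (Subgroup.closure ({⟨1, 0⟩, ⟨0, 1⟩, ⟨0, 2⟩} : Set (Iw p))).topologicalClosure = ⊤ := by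
  set H := Subgroup.closure ({⟨1, 0⟩, ⟨0, 1⟩, ⟨0, 2⟩} : Set (Iw p)) with hH
  have hα : (⟨1, 0⟩ : Iw p) ∈ H := Subgroup.subset_closure (Set.mem_insert _ _)
  have h1 : (⟨0, 1⟩ : Iw p) ∈ H := Subgroup.subset_closure (Set.mem_insert_of_mem _ (Set.mem_insert _ _))
  have h2 : (⟨0, 2⟩ : Iw p) ∈ H :=
    Subgroup.subset_closure (Set.mem_insert_of_mem _ (Set.mem_insert_of_mem _ rfl))
  rw [eq_top_iff]
  intro x _
  have hx : x = ⟨x.a, 0⟩ * ⟨0, x.s⟩ := by ext <;> simp [w]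
  rw [hx]
  exact H.topologicalClosure.mul_mem (transl_mem_topologicalClosure H hα x.a)
    (torus_mem_topologicalClosure H h1 h2 x.s)

/-- `P` is topologically generated by a `Finset` of cardinality `≤ 3`.
[cite: MochizukiSemiAnbd2006, Def 2.3(iii) p.25] -/
theorem exists_finset_topologicalClosure_eq_top :
    ∃ s : Finset (Iw p), s.card ≤ 3 ∧ (Subgroup.closure (s : Set (Iw p))).topologicalClosure = ⊤ := by
  classical
  refine ⟨{⟨1, 0⟩, ⟨0, 1⟩, ⟨0, 2⟩}, Finset.card_le_three, ?_⟩
  rw [Finset.coe_insert, Finset.coe_insert, Finset.coe_singleton]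
  exact topologicalClosure_closure_triple

end Iw

/-! ## 3. `𝒢₁` is coherent and strictly coherent -/

namespace IwahoriWitness

variable (p)

/-- **`𝒢₁` is coherent** (Def. 2.3 (iii)): quasi-coherent (`loopGraph_isQuasiCoherent`) with
topologically finitely generated vertex group `P` and edge group `U`.
[cite: MochizukiSemiAnbd2006, Def 2.3(iii) p.25] -/
theorem loopGraph_isCoherent : (loopGraph p).IsCoherent := by
  refine ⟨loopGraph_isQuasiCoherent p, fun _ => ?_, fun _ => ?_⟩
  · obtain ⟨s, -, hs⟩ := Iw.exists_finset_topologicalClosure_eq_top (p := p)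
    exact ⟨s, hs⟩
  · obtain ⟨s, -, hs⟩ := IwU.exists_finset_topologicalClosure_eq_top (p := p)
    exact ⟨s, hs⟩

/-- `𝒢₁`'s underlying semi-graph (one vertex, one edge) is finite. [cite: MochizukiSemiAnbd2006, §1 p.11] -/
theorem loopGraph_isFinite : (loopGraph p).graph.IsFinite :=
  ⟨inferInstanceAs (Finite PUnit), inferInstanceAs (Finite (ULift (Fin 1)))⟩

/-- **`𝒢₁` is strictly coherent** ([IUTchI] Rmk. 2.5.3 (i) (T3): finite and coherent).
[cite: Mochizuki2012, IUTchI Rem. 2.5.3(i)(T3) p.53] -/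
theorem loopGraph_isStrictlyCoherent : (loopGraph p).IsStrictlyCoherent :=
  ProfiniteSemiGraph.isStrictlyCoherent_of_finite (loopGraph_isFinite p) (loopGraph_isCoherent p)

/-! ## 4. Thm 3.7 (iii)/(iv) AT the universal graph-covering `𝒢₁,∞` — the literal instances of
`UniversalCoveringCompactInVerticial` at the estranged loop -/

open ProfiniteSemiGraph

/-- The one-sheeted trivial covering of `𝒢₁` has a vertex-orbit (base points for `𝒢₁,∞` exist).
[cite: MochizukiSemiAnbd2006, Def 3.5(i) p.37] -/
theorem nonempty_oVertex_trivialCov_loopGraph :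
    Nonempty (CovObj.trivialCov (loopGraph p) PUnit.{1}).OVertex :=
  nonempty_oVertex_trivialCov_punit (loopGraph_hasVertex p)

/-- **[SemiAnbd] Thm 3.7 (iii) AT `𝒢₁,∞`** (F-1732 At-form, hypothesis-free): at the covering semi-graph of
anabelioids of the universal graph-covering of the estranged loop — the bi-infinite chain of copies of
`P = ℤ_p ⋊ (1 + pℤ_p)` glued along `U = 1 + pℤ_p` — every compact subgroup of `π₁^temp` lies in a verticial
subgroup (every chart, every base vertex-orbit). [cite: MochizukiSemiAnbd2006, Thm 3.7(iii) pp.40-41] -/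
theorem compactInVerticialAt_univCover_loopGraph
    (V₀ : (CovObj.trivialCov (loopGraph p) PUnit.{1}).OVertex) :
    CompactInVerticialAt
      ((CovObj.trivialCov (loopGraph p) PUnit.{1}).univCoverOver (Sum.inl V₀)
        (loopGraph_thm37Hypotheses p).isCountable).coveringGraph := by
  haveI : Finite (loopGraph p).graph.Vertex := (loopGraph_isFinite p).finite_vertex
  haveI : Finite (loopGraph p).graph.Edge := (loopGraph_isFinite p).finite_edge
  exact compactInVerticialAt_univCover (loopGraph_thm37Hypotheses p) (loopGraph_isCoherent p) V₀

/-- **[SemiAnbd] Thm 3.7 (iv) AT `𝒢₁,∞`** (F-1750 At-form, hypothesis-free): maximal compact subgroups of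
`π₁^temp(𝒢₁,∞)` are exactly the verticial subgroups (and the edge clause).
[cite: MochizukiSemiAnbd2006, Thm 3.7(iv) p.41] -/
theorem maximalCompactIffVerticialAt_univCover_loopGraph
    (V₀ : (CovObj.trivialCov (loopGraph p) PUnit.{1}).OVertex) :
    MaximalCompactIffVerticialAt
      ((CovObj.trivialCov (loopGraph p) PUnit.{1}).univCoverOver (Sum.inl V₀)
        (loopGraph_thm37Hypotheses p).isCountable).coveringGraph := by
  haveI : Finite (loopGraph p).graph.Vertex := (loopGraph_isFinite p).finite_vertex
  haveI : Finite (loopGraph p).graph.Edge := (loopGraph_isFinite p).finite_edge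
  exact maximalCompactIffVerticialAt_univCover (loopGraph_thm37Hypotheses p) (loopGraph_isCoherent p) V₀

/-- `𝒢₁,∞` itself satisfies the hypotheses of Thm 3.7 and is strictly coherent (so the two At-forms
above are statements about a genuine Thm-3.7 graph). [cite: MochizukiSemiAnbd2006, Thm 3.7 p.40] -/
theorem thm37Hypotheses_univCover_loopGraph
    (V₀ : (CovObj.trivialCov (loopGraph p) PUnit.{1}).OVertex) :
    ((CovObj.trivialCov (loopGraph p) PUnit.{1}).univCoverOver (Sum.inl V₀)
        (loopGraph_thm37Hypotheses p).isCountable).coveringGraph.Thm37Hypotheses ∧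
      ((CovObj.trivialCov (loopGraph p) PUnit.{1}).univCoverOver (Sum.inl V₀)
        (loopGraph_thm37Hypotheses p).isCountable).coveringGraph.IsStrictlyCoherent := by
  haveI : Finite (loopGraph p).graph.Vertex := (loopGraph_isFinite p).finite_vertex
  haveI : Finite (loopGraph p).graph.Edge := (loopGraph_isFinite p).finite_edge
  exact thm37Hypotheses_univCover (loopGraph_thm37Hypotheses p) (loopGraph_isCoherent p) V₀

/-- Thm 3.7 (iii) AT `𝒢₁,∞,F` for every FINITE covering object `F` of `𝒢₁` and base vertex-orbit.
[cite: MochizukiSemiAnbd2006, Thm 3.7(iii) pp.40-41] -/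
theorem compactInVerticialAt_univCoverOver_loopGraph (F : CovObj (loopGraph p)) (hF : F.IsFinite)
    (V₀ : F.OVertex) :
    CompactInVerticialAt (F.univCoverOver (Sum.inl V₀) (loopGraph_thm37Hypotheses p).isCountable).coveringGraph := by
  haveI : Finite (loopGraph p).graph.Vertex := (loopGraph_isFinite p).finite_vertex
  haveI : Finite (loopGraph p).graph.Edge := (loopGraph_isFinite p).finite_edge
  exact F.compactInVerticialAt_univCoverOver (loopGraph_thm37Hypotheses p) (loopGraph_isCoherent p) hF V₀

/-- Thm 3.7 (iv) AT `𝒢₁,∞,F` for every FINITE covering object `F` of `𝒢₁` and base vertex-orbit.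
[cite: MochizukiSemiAnbd2006, Thm 3.7(iv) p.41] -/
theorem maximalCompactIffVerticialAt_univCoverOver_loopGraph (F : CovObj (loopGraph p)) (hF : F.IsFinite)
    (V₀ : F.OVertex) :
    MaximalCompactIffVerticialAt
      (F.univCoverOver (Sum.inl V₀) (loopGraph_thm37Hypotheses p).isCountable).coveringGraph := by
  haveI : Finite (loopGraph p).graph.Vertex := (loopGraph_isFinite p).finite_vertex
  haveI : Finite (loopGraph p).graph.Edge := (loopGraph_isFinite p).finite_edge
  exact F.maximalCompactIffVerticialAt_univCoverOver (loopGraph_thm37Hypotheses p) (loopGraph_isCoherent p) hF V₀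

/-- NON-VACUITY OF THE CLASS «finite coherent Thm-3.7 graph with an edge» at which p456054 is stated, with
the At-forms at its universal graph-covering: witnessed by `𝒢₁` (at `p = 2`, say).
[cite: MochizukiSemiAnbd2006, Thm 3.7(iii)(iv) pp.40-41] -/
theorem exists_finite_coherent_thm37_graph_univCover :
    ∃ (𝒢 : ProfiniteSemiGraph.{0}) (h37 : 𝒢.Thm37Hypotheses), 𝒢.IsStrictlyCoherent ∧ 𝒢.graph.IsFinite ∧
      Nonempty 𝒢.graph.Edge ∧ Nonempty (CovObj.trivialCov 𝒢 PUnit.{1}).OVertex ∧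
      ∀ V₀ : (CovObj.trivialCov 𝒢 PUnit.{1}).OVertex,
        CompactInVerticialAt
            ((CovObj.trivialCov 𝒢 PUnit.{1}).univCoverOver (Sum.inl V₀) h37.isCountable).coveringGraph ∧
          MaximalCompactIffVerticialAt
            ((CovObj.trivialCov 𝒢 PUnit.{1}).univCoverOver (Sum.inl V₀) h37.isCountable).coveringGraph :=
  haveI : Fact (Nat.Prime 2) := ⟨Nat.prime_two⟩
  ⟨loopGraph 2, loopGraph_thm37Hypotheses 2, loopGraph_isStrictlyCoherent 2, loopGraph_isFinite 2,
    ⟨ULift.up (0 : Fin 1)⟩, nonempty_oVertex_trivialCov_loopGraph 2, fun V₀ =>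
      ⟨compactInVerticialAt_univCover_loopGraph 2 V₀, maximalCompactIffVerticialAt_univCover_loopGraph 2 V₀⟩⟩

end IwahoriWitness

end Literature.AnabelianGeometry.SemiGraphs
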